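import Mathlib
import Summits.Parity.GeneralizedHardyLittlewood.Theorems.FordMaynardSieveConst01651SieveConst01651HwtSplit

/-!
# Route `FordMaynardSieveConst01651`, target `SieveConst01651` (stmt-Parity-19185), line `sieve_decomposition`:
# helpers towards `stub_typeIIRegion` — `H(n)` indexed by the subsets of the prime factors of the rough part

Ford–Maynard, arXiv:2407.14368v1, proof of Proposition 7.22, second display of p. 40: for `n = n₁ p₁⋯p_k`
(`n₁` the `n^σ`-smooth part, `p₁ ≤ ⋯ ≤ p_k` the primes `> n^σ`),
`H(n) = ∑_{u ∣ n₁} ∑_{J ⊆ [k]} 𝟙(u ∏_{j∈J} p_j ≤ n^γ) λ(u) g(v(∏_{j∈J} p_j; n))`.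
As printed this indexes the divisors `m ∣ n₂` of the rough part by index sets `J`, which is a bijection exactly when
`n₂ = p₁⋯p_k` is SQUAREFREE (for a repeated prime the `J`-sum double-counts; those `n` need a separate patch).  This
file proves the squarefree case in the tree's vocabulary (`λ = μ`, `σ = ν`, `γ = 1/2`; `Hwt`, `Gwt`, `pvec`,
`roughPart`, `smoothPart` of …SieveConst01651Defs; `J` ↦ the sub-finset `S ⊆ primeFactors n₂`, `∏_{j∈J} p_j = ∏_{p∈S} p`),
on top of g0's `Hwt_eq_sum_smooth_rough` (…HwtSplit) and Mathlib's `Nat.sum_divisors_filter_squarefree`.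
Def-free. Nothing here proves anything about the Parity summit.
-/

noncomputable section

open Finset
open Literature.NumberTheory.Sieve Literature.NumberTheory.Sieve.FordMaynard

namespace Summit.Parity.GeneralizedHardyLittlewood.FordMaynardSieveConst01651SieveConst01651

/-- Divisor sums of a squarefree number as sums over subsets of its prime factors:
`∑_{m ∣ N} F(m) = ∑_{S ⊆ primeFactors N} F(∏_{p∈S} p)`. [folklore] -/
theorem sum_divisors_eq_sum_powerset_primeFactors {N : ℕ} (hN : Squarefree N) {α : Type*} [AddCommMonoid α]
    (F : ℕ → α) : ∑ m ∈ N.divisors, F m = ∑ S ∈ N.primeFactors.powerset, F (∏ p ∈ S, p) := by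
  rw [← Nat.divisors_filter_squarefree_of_squarefree hN, Nat.sum_divisors_filter_squarefree hN.ne_zero,
    Nat.factors_eq]
  refine Finset.sum_congr rfl fun S _ => ?_
  rw [Finset.prod_val]
  rfl

/-- **`H(n)` over `(u, S)`, `u ∣ n₁`, `S ⊆ primeFactors n₂`** (Ford–Maynard's expansion of `H(n)` in the proof of
Proposition 7.22, at `λ = μ`, `σ = ν`, `γ = 1/2`), valid whenever the rough part `n₂ = roughPart n^ν n` is
squarefree: `H(n) = ∑_{u ∣ n₁} ∑_{S ⊆ primeFactors n₂} 𝟙[u ∏_{p∈S} p ≤ n^{1/2}] μ(u) g(𝐯(∏_{p∈S} p; n))`.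
[cite: FordMaynard2024PrimeSieves, proof of Proposition 7.22 (expansion of H(n), p. 40)] -/
theorem Hwt_eq_sum_smooth_powerset (g : VecFn) (ν : ℝ) {n : ℕ} (hn : n ≠ 0)
    (hsq : Squarefree (roughPart ((n : ℝ) ^ ν) n)) :
    Hwt g ν n = ∑ u ∈ (smoothPart ((n : ℝ) ^ ν) n).divisors,
      ∑ S ∈ (roughPart ((n : ℝ) ^ ν) n).primeFactors.powerset,
        if ((u * ∏ p ∈ S, p : ℕ) : ℝ) ≤ (n : ℝ) ^ (1 / 2 : ℝ) then
          ((ArithmeticFunction.moebius u : ℤ) : ℝ) * g _ (pvec n (∏ p ∈ S, p)) else 0 := by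
  rw [Hwt_eq_sum_smooth_rough g ν hn]
  refine Finset.sum_congr rfl fun u _ => ?_
  exact sum_divisors_eq_sum_powerset_primeFactors hsq _

/-- For squarefree `n₂`, the subsets `S` of its prime factors are in bijection with its divisors and
`#primeFactors n₂ = Ω(n₂)`: the number of index sets is `2^k` with `k` the number of prime factors (with
multiplicity) of the rough part. [folklore] -/
theorem card_powerset_primeFactors_of_squarefree {N : ℕ} (hN : Squarefree N) :
    N.primeFactors.powerset.card = 2 ^ N.primeFactorsList.length := by
  rw [Finset.card_powerset, ← List.toFinset_card_of_nodup hN.nodup_primeFactorsList]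
  rfl

end Summit.Parity.GeneralizedHardyLittlewood.FordMaynardSieveConst01651SieveConst01651

end
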